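import Literature.MathematicalPhysics.QuantumLattice.SalmhoferCutoffGevrey
import Literature.Analysis.Calculus.SmoothTransitionDerivBound
import HarnessLib

/-!
# A realistic Lipschitz constant for Salmhofer's cutoff: `|χ₂′(y)| ≤ 4` for every `y`

Topic `MathematicalPhysics/QuantumLattice`; sharpens `SalmhoferCutoffGevrey.abs_deriv_salmhoferCutoff_le_numeral` (`≤ 2736`, the `n = 1` row of the
all-orders Gevrey table) to the realistic `4` (true supremum `8/3`), from `Literature.Analysis.Calculus.abs_deriv_smoothTransition_le_three` and the affine
chain rule `χ₂′(y) = (4/3)·smoothTransition′((4y − 1)/3)` (`iteratedDeriv_salmhoferCutoff`).  This is the `B₁` of every single-scale Lipschitz line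
`|χ₂(a) − χ₂(b)| ≤ B₁|a − b|` of the multiscale bookkeeping (`abs_uvWeightFn_sub_le`, the frame-response doors' `hB`; Disertori–Rivasseau 2000 §II.2, BGM 2006 §2.2
(2.9): the cutoff's constants), e.g. the factor `(200 + 200B₁)` of the cell gate-hubbard-kl's (B) door MAIN term: `547 400 ↦ 1 000`.

* **`abs_deriv_salmhoferCutoff_le_four`** — `|χ₂′(y)| ≤ 4`;  `salmhoferCutoff_lipschitz_four` — `|χ₂(a) − χ₂(b)| ≤ 4|a − b|`.

Everything is proved; no definitions; no named facts.

## Sources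

M. Salmhofer, *Renormalization*, Springer 1999, §4.2.5 (4.71) [`Salmhofer1999`];
M. Disertori, V. Rivasseau, Commun. Math. Phys. 215 (2000) 251–290, §II.2 (II.13)–(II.14) [`DisertoriRivasseau2000`].
-/

noncomputable section

namespace Literature.MathematicalPhysics.QuantumLattice

open Real Literature.Analysis.Calculus

/-- **`|χ₂′(y)| ≤ 4`** for every `y` (`χ₂′(y) = (4/3)·smoothTransition′((4y−1)/3)`, `|smoothTransition′| ≤ 3`). [cite: Salmhofer1999, §4.2.5 (4.71)] -/
theorem abs_deriv_salmhoferCutoff_le_four (y : ℝ) : |deriv salmhoferCutoff y| ≤ 4 := by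
  have h := iteratedDeriv_salmhoferCutoff 1 y
  rw [iteratedDeriv_one, iteratedDeriv_one, pow_one] at h
  rw [h, abs_mul, abs_of_pos (by norm_num : (0 : ℝ) < 4 / 3)]
  have h3 := abs_deriv_smoothTransition_le_three ((4 / 3 : ℝ) * y - 1 / 3)
  linarith

/-- **The Lipschitz line with `B₁ = 4`**: `|χ₂(a) − χ₂(b)| ≤ 4·|a − b|`. [cite: Salmhofer1999, §4.2.5 (4.71)] -/
theorem salmhoferCutoff_lipschitz_four (a b : ℝ) : |salmhoferCutoff a - salmhoferCutoff b| ≤ 4 * |a - b| := by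
  have h := Convex.norm_image_sub_le_of_norm_deriv_le (f := salmhoferCutoff) (s := Set.univ) (C := 4)
    (fun y _ => (contDiff_salmhoferCutoff (n := 2)).differentiable (by norm_num) y)
    (fun y _ => by rw [Real.norm_eq_abs]; exact abs_deriv_salmhoferCutoff_le_four y) convex_univ (Set.mem_univ b) (Set.mem_univ a)
  simpa [Real.norm_eq_abs] using h

end Literature.MathematicalPhysics.QuantumLattice

end
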